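import Summits.QuantumFields.YangMills.Theorems.BalabanUVNodesN15FullPropagatorExactSiteSocketWords

/-!
# Route «BalabanUVNodes», cluster K4 «SpineRates» — node N15 = NE2: THE SITE LAYER WITH THE BACKGROUND LIVE IN THE TwoGrid ENTRY CURRENCY, VI — THE FULL (3.65) WORDS: the site
# socket's three letters from a dressed scalar layer's block letters WITH THE AVERAGING SPECIES `F₂ = Q′(U′U) − Q′`, `F₂* = Q′*(U′U) − Q′*` LIVE (dag-n15-c S2 by name, every term of
# (3.65)), hence `NE2PlusSite` with the background live on the general carrier from the `U ≡ 1` scalar layer + its dressed twin + the averaging species' letters ALONE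

Cell `pub-ymgap`, WIDTH SEAT `pub-ymgap-dag-n15-w1` (generation 0; director-ym №197 ∕ HUMAN RULING D-0149; chair R455 (A) ∕ R461; plan g77 `W-SEAT-START-LIST.md` §2 n15 ITEM 1 —
bus CLAIM pub-ymgap INBOX l.24149).  `bears_on: R4∕N15 · K3⁷ SpineGivenEndpointR13SepCoPH (stmt-QuantumFields-20544)`.  Filed `--kind definition --supports stmt-QuantumFields-20544
--as helper` — COUNT-NEUTRAL.  One data `def` (`sitePert365F`), the rest theorems; 0 `sorry`.  Imports this seat's part V `…N15FullPropagatorExactSiteSocketWords` (`siteEntries`,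
`sitePert365`, `abs_siteEntries_le_of_hasMaj`, `siteForm_zero_zero`, `idef_zero_zero`; part IV's socket; dag-n15-c S2 through it); nothing in the tree is modified.

WHY.  Part V dropped the averaging species (`F₂ = 0`): right for a SCALAR model whose block averaging does not see the background (King's rung), NOT for Bałaban's
`Q′(U) = Q′` with parallel transports, where [Balaban1985BackgroundPropagators] (3.58)∕(3.65) p. 402–403 has `Q′(U′U) = Q′(U) + F′₂(A)` and `C(A)` carries the words
`F′₂G′²Q′* + Q′G′²F′₂* + F′₂G′²F′₂* + …`.  dag-n15-c S2 `hasMaj_siteC` ∕ `hasMaj_idef_siteForm` already treat the general words with species letters `F₂, F₂* ≤ diagK r` and fits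
`𝔇(F₂′, F₂) ≤ diagK o` (dag-n15-c F7∕F9 construct such species at `U ≡ 1`).  THIS FILE is part V with those letters LIVE: `r = r₀α₀` (species small in `α₀`), `o = o₀·(L^k)^{−γ_P}` (fits
rate-small) — the bridge from a lane's dressed scalar layer AND averaging species, in their block-letter currency, to the site sockets' three entry letters and to `NE2PlusSite` BY NAME.

CONTENTS.  §1 def `sitePert365F q F Fs G X := siteForm q F Fs X − siteForm₀ q G`, `sitePert365F_zero_zero` (`F = Fs = 0` ⟹ part V's `sitePert365`), ★ `hasMaj_sitePert365F` (SIZE: S2 `hasMaj_siteC`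
with `r` live), `sitePert365F_sub`, ★★ `hasMaj_sitePert365F_sub` (TWO-GRID: S2 `hasMaj_idef_siteForm` with the species' fits live, minus the `U ≡ 1` words' defect).  §2 ★★★
**`siteLettersF_of_dressedLetters`** (uniformly over a family: block letters of `G`, `X(U)`, `F₂(U)`, `F₂*(U)` ⟹ parts II∕IV's `hP`).  §3 ★★★ **`ne2PlusSite_sSiteExOn_of_dressedLettersF`**
(part IV's socket ∘ §2).

HONEST FRAMING.  Count-neutral, species-independent BRIDGE (kernel bookkeeping + S2 ∕ parts IV–V by name); every layer and species is a HYPOTHESIS here; MODEL level wherever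
instantiated; the lane's dictionary `siteForm₀ q G = Q′G′²Q′*` is the lane's.  NOT [B9] Thm 3.2 at a general (3.35)-regular `U` (NE2⁺ NOT PRINTED as an η-rate); Node 00's [B9]
layers of record are residual — **N15 is NOT discharged** (typed 28∕28 · discharged 5∕27 of record unchanged); one finite four-torus programme at fixed `ε` — NOT ℝ⁴, NOT infinite
volume, NOT OS, NOT a mass gap, NOT Clay; R4 closes the conditional finite-𝕋⁴ rung `BalabanLadder.UV` only.  Restate-immune (no Theses import).
-/

set_option autoImplicit false

noncomputable section

open scoped BigOperators Matrix
open Finset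

namespace Summit.QuantumFields.YangMills.BalabanUVNodes.N15.SiteLayerBg

open Literature.MathematicalPhysics.QuantumFieldTheory.Balaban1983to89
open Literature.MathematicalPhysics.QuantumFieldTheory.Balaban1983to89.B11SectG (BlockNorm HasMaj RowSum hasMaj_zero)
open Literature.MathematicalPhysics.QuantumFieldTheory.Balaban1983to89.T4EtaRateDefect (idef)
open Literature.MathematicalPhysics.QuantumFieldTheory.Balaban1983to89.T4EtaRateCoeffDefect (pull diagK diagK_nonneg fibre)
open Literature.MathematicalPhysics.QuantumFieldTheory.Balaban1983to89.B6RandomWalk (Triangle254)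
open Literature.MathematicalPhysics.QuantumFieldTheory.Balaban1983to89.B5Prop11Plancherel (Tor)
open Literature.MathematicalPhysics.QuantumFieldTheory.Balaban1983to89.B4Sect5Torus (tdist)
open Literature.MathematicalPhysics.QuantumFieldTheory.Balaban1983to89.B4Sect5Proof (latticeConst latticeConst_nonneg)
open Literature.MathematicalPhysics.QuantumFieldTheory.Balaban1983to89.B5QGGQ145Bounds (Idx)
open Literature.MathematicalPhysics.QuantumFieldTheory.Balaban1983to89.B5PBridgeProjection (torIdx)
open Literature.MathematicalPhysics.QuantumFieldTheory.Balaban1983to89.B6UnitTorusCarrier (triangle254_unitTorusGeo rowSum_unitTorusGeo)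
open Literature.MathematicalPhysics.QuantumFieldTheory.King1986.Torus (tdistT tdistT_nonneg)
open Summit.QuantumFields.YangMills.BalabanUVNodes.N15.VectorPiece (unitTorusGeoS unitTorusGeoS_dist)
open Summit.QuantumFields.YangMills.BalabanUVNodes.N15.SiteLayer (siteForm siteForm₀ hasMaj_siteC hasMaj_idef_siteForm hasMaj_add_exp hasMaj_exp_mono)

variable {d : ℕ} {L : ℕ}

/-! ## §1 The full (3.65) site perturbation (averaging species live): size letter and two-grid letter from block letters -/

section Words

variable {Xc : Type} [Fintype Xc] (M : Fin (d + 1) → ℕ)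

/-- **THE SITE PERTURBATION OF (3.65), AVERAGING SPECIES LIVE**: `siteForm q F Fs X − siteForm₀ q G = F X²(Q* + Fs) + Q X² Fs + Q(X(X − G) + (X − G)G)Q*` (dag-n15-c S2
`siteForm_sub_siteForm₀`) — `F = Q′(U′U) − Q′`, `Fs = Q′*(U′U) − Q′*`. [cite: Balaban1985BackgroundPropagators, (3.58) p.402, (3.65) p.403 (shape)] -/
def sitePert365F (q : Xc → Tor M) (F : (Xc → ℝ) →ₗ[ℝ] (Tor M → ℝ)) (Fs : (Tor M → ℝ) →ₗ[ℝ] (Xc → ℝ)) (G Xo : (Xc → ℝ) →ₗ[ℝ] (Xc → ℝ)) : (Tor M → ℝ) →ₗ[ℝ] (Tor M → ℝ) :=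
  siteForm q F Fs Xo - siteForm₀ q G

/-- At `F = Fs = 0` the full words are part V's. [folklore] -/
theorem sitePert365F_zero_zero (q : Xc → Tor M) (G Xo : (Xc → ℝ) →ₗ[ℝ] (Xc → ℝ)) : sitePert365F M q 0 0 G Xo = sitePert365 M q G Xo := rfl

/-- ★ **THE SIZE LETTER, SPECIES LIVE** (S2 `hasMaj_siteC`): from `X ≤ B·e^{−δd}`, `G ≤ β·e^{−δd}`, `X − G ≤ ε·e^{−δd}`, `F, Fs ≤ diagK r` (`B, β, ε, r ≥ 0`, `δ > 0`):
`sitePert365F ≤ (r·B²(1 + r) + B²r + (B + β)ε)·c_δ·e^{−(δ∕2)d}` between the sharp site norms of `unitTorusGeoS L k M M_sz`. [cite: Balaban1985BackgroundPropagators, (3.66) p.403 (shape)] -/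
theorem hasMaj_sitePert365F [∀ μ, NeZero (M μ)] (k : ℕ) (Msz : ℝ) (q : Xc → Tor M) {F : (Xc → ℝ) →ₗ[ℝ] (Tor M → ℝ)} {Fs : (Tor M → ℝ) →ₗ[ℝ] (Xc → ℝ)}
    {G Xo : (Xc → ℝ) →ₗ[ℝ] (Xc → ℝ)} {B β ε r δ : ℝ} (hB : 0 ≤ B) (hβ : 0 ≤ β) (hε : 0 ≤ ε) (hr : 0 ≤ r) (hδ : 0 < δ)
    (hX : HasMaj (BlockNorm.ofBlocks (unitTorusGeoS L k M Msz) q) (BlockNorm.ofBlocks (unitTorusGeoS L k M Msz) q) Xo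
      (fun y y' => B * Real.exp (-(δ * (unitTorusGeoS L k M Msz).dist y y'))))
    (hG : HasMaj (BlockNorm.ofBlocks (unitTorusGeoS L k M Msz) q) (BlockNorm.ofBlocks (unitTorusGeoS L k M Msz) q) G
      (fun y y' => β * Real.exp (-(δ * (unitTorusGeoS L k M Msz).dist y y'))))
    (hE : HasMaj (BlockNorm.ofBlocks (unitTorusGeoS L k M Msz) q) (BlockNorm.ofBlocks (unitTorusGeoS L k M Msz) q) (Xo - G)
      (fun y y' => ε * Real.exp (-(δ * (unitTorusGeoS L k M Msz).dist y y'))))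
    (hF : HasMaj (BlockNorm.ofBlocks (unitTorusGeoS L k M Msz) q) (BlockNorm.ofBlocks (unitTorusGeoS L k M Msz) (fun y : Tor M => y)) F (diagK fun _ => r))
    (hFs : HasMaj (BlockNorm.ofBlocks (unitTorusGeoS L k M Msz) (fun y : Tor M => y)) (BlockNorm.ofBlocks (unitTorusGeoS L k M Msz) q) Fs (diagK fun _ => r)) :
    HasMaj (BlockNorm.ofBlocks (unitTorusGeoS L k M Msz) (fun y : Tor M => y)) (BlockNorm.ofBlocks (unitTorusGeoS L k M Msz) (fun y : Tor M => y)) (sitePert365F M q F Fs G Xo)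
      (fun y y' => (r * (B * B * (1 + r)) + B * B * r + (B + β) * ε) * latticeConst (d + 1) (δ / 2) * Real.exp (-(δ / 2 * (unitTorusGeoS L k M Msz).dist y y'))) := by
  have hK : 0 ≤ latticeConst (d + 1) (δ / 2) := latticeConst_nonneg _ (by positivity)
  exact hasMaj_siteC (g := unitTorusGeoS L k M Msz) (σ := δ / 2) (cr := latticeConst (d + 1) (δ / 2)) (triangle254_unitTorusGeo L k M)
    (fun a b => tdistT_nonneg M a b) (rowSum_unitTorusGeo L k M (half_pos hδ)) (by positivity) hK q (fun y : Tor M => y) q (fun _ => rfl)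
    hB hβ hε hr (by positivity : (0 : ℝ) ≤ δ / 2) (by linarith) hX hG hE hF hFs

/-- **THE TWO-GRID DIFFERENCE OF THE FULL WORDS IS A DIFFERENCE OF TWO η-DEFECTS**: `C′ − C = 𝔇(siteForm (q ∘ π) F′ Fs′ X′, siteForm q F Fs X) − 𝔇(siteForm₀′, siteForm₀)` through the
identity transport of the common site lattice. [folklore] -/
theorem sitePert365F_sub {Xf : Type} [Fintype Xf] (q : Xc → Tor M) (π : Xf → Xc) (F : (Xc → ℝ) →ₗ[ℝ] (Tor M → ℝ)) (Fs : (Tor M → ℝ) →ₗ[ℝ] (Xc → ℝ))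
    (F' : (Xf → ℝ) →ₗ[ℝ] (Tor M → ℝ)) (Fs' : (Tor M → ℝ) →ₗ[ℝ] (Xf → ℝ)) (G Xo : (Xc → ℝ) →ₗ[ℝ] (Xc → ℝ)) (G' Xo' : (Xf → ℝ) →ₗ[ℝ] (Xf → ℝ)) :
    sitePert365F M (q ∘ π) F' Fs' G' Xo' - sitePert365F M q F Fs G Xo =
      idef LinearMap.id LinearMap.id (siteForm (q ∘ π) F' Fs' Xo') (siteForm q F Fs Xo) - idef LinearMap.id LinearMap.id (siteForm (q ∘ π) 0 0 G') (siteForm q 0 0 G) := by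
  unfold sitePert365F idef
  rw [siteForm_zero_zero, siteForm_zero_zero, LinearMap.comp_id, LinearMap.id_comp, LinearMap.comp_id, LinearMap.id_comp]
  abel

/-- ★★ **THE TWO-GRID LETTER, SPECIES LIVE** (fine `(q ∘ π, F′, Fs′, G′, X′)` against coarse `(q, F, Fs, G, X)`, King's pairing `π` with UNIFORM fibres): from the layers' sizes
`X, X′ ≤ B·e^{−δd}`, `G, G′ ≤ β·e^{−δd}`, the species' sizes `F, Fs, F′, Fs′ ≤ diagK r`, the two-grid defects `𝔇^π(X′, X) ≤ m·e^{−δd}`, `𝔇^π(G′, G) ≤ m₀·e^{−δd}` and the species'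
fits `𝔇(F′, F) ≤ diagK o` (through `(τ, 1)`), `𝔇(Fs′, Fs) ≤ diagK o` (through `(1, τ)`): `C′ − C ≤ [2(1 + r)Bc_δ(Bo + m(1 + r)) + 2βc_δm₀]·e^{−(δ∕2)d}` — S2 `hasMaj_idef_siteForm` (species
live) minus the `U ≡ 1` words' defect (S2 at `F ≡ 0`, `X := G`). [cite: Balaban1985BackgroundPropagators, (3.65)–(3.66) p.403 (mechanism); King1986, p.664 (pairing convention)] -/
theorem hasMaj_sitePert365F_sub [∀ μ, NeZero (M μ)] [DecidableEq Xc] {Xf : Type} [Fintype Xf] (k : ℕ) (Msz : ℝ) (q : Xc → Tor M) (π : Xf → Xc) {N : ℕ} (hN : N ≠ 0)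
    (hfib : ∀ x, (fibre π x).card = N) {F : (Xc → ℝ) →ₗ[ℝ] (Tor M → ℝ)} {Fs : (Tor M → ℝ) →ₗ[ℝ] (Xc → ℝ)} {F' : (Xf → ℝ) →ₗ[ℝ] (Tor M → ℝ)}
    {Fs' : (Tor M → ℝ) →ₗ[ℝ] (Xf → ℝ)} {G Xo : (Xc → ℝ) →ₗ[ℝ] (Xc → ℝ)} {G' Xo' : (Xf → ℝ) →ₗ[ℝ] (Xf → ℝ)} {B β m m₀ r o δ : ℝ}
    (hB : 0 ≤ B) (hβ : 0 ≤ β) (hm : 0 ≤ m) (hm₀ : 0 ≤ m₀) (hr : 0 ≤ r) (ho : 0 ≤ o) (hδ : 0 < δ)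
    (hX : HasMaj (BlockNorm.ofBlocks (unitTorusGeoS L k M Msz) q) (BlockNorm.ofBlocks (unitTorusGeoS L k M Msz) q) Xo
      (fun y y' => B * Real.exp (-(δ * (unitTorusGeoS L k M Msz).dist y y'))))
    (hX' : HasMaj (BlockNorm.ofBlocks (unitTorusGeoS L k M Msz) (q ∘ π)) (BlockNorm.ofBlocks (unitTorusGeoS L k M Msz) (q ∘ π)) Xo'
      (fun y y' => B * Real.exp (-(δ * (unitTorusGeoS L k M Msz).dist y y'))))
    (hDX : HasMaj (BlockNorm.ofBlocks (unitTorusGeoS L k M Msz) q) (BlockNorm.ofBlocks (unitTorusGeoS L k M Msz) (q ∘ π)) (idef (pull π) (pull π) Xo' Xo)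
      (fun y y' => m * Real.exp (-(δ * (unitTorusGeoS L k M Msz).dist y y'))))
    (hG : HasMaj (BlockNorm.ofBlocks (unitTorusGeoS L k M Msz) q) (BlockNorm.ofBlocks (unitTorusGeoS L k M Msz) q) G
      (fun y y' => β * Real.exp (-(δ * (unitTorusGeoS L k M Msz).dist y y'))))
    (hG' : HasMaj (BlockNorm.ofBlocks (unitTorusGeoS L k M Msz) (q ∘ π)) (BlockNorm.ofBlocks (unitTorusGeoS L k M Msz) (q ∘ π)) G'
      (fun y y' => β * Real.exp (-(δ * (unitTorusGeoS L k M Msz).dist y y'))))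
    (hDG : HasMaj (BlockNorm.ofBlocks (unitTorusGeoS L k M Msz) q) (BlockNorm.ofBlocks (unitTorusGeoS L k M Msz) (q ∘ π)) (idef (pull π) (pull π) G' G)
      (fun y y' => m₀ * Real.exp (-(δ * (unitTorusGeoS L k M Msz).dist y y'))))
    (hFs : HasMaj (BlockNorm.ofBlocks (unitTorusGeoS L k M Msz) (fun y : Tor M => y)) (BlockNorm.ofBlocks (unitTorusGeoS L k M Msz) q) Fs (diagK fun _ => r))
    (hF' : HasMaj (BlockNorm.ofBlocks (unitTorusGeoS L k M Msz) (q ∘ π)) (BlockNorm.ofBlocks (unitTorusGeoS L k M Msz) (fun y : Tor M => y)) F' (diagK fun _ => r))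
    (hFs' : HasMaj (BlockNorm.ofBlocks (unitTorusGeoS L k M Msz) (fun y : Tor M => y)) (BlockNorm.ofBlocks (unitTorusGeoS L k M Msz) (q ∘ π)) Fs' (diagK fun _ => r))
    (hDF : HasMaj (BlockNorm.ofBlocks (unitTorusGeoS L k M Msz) q) (BlockNorm.ofBlocks (unitTorusGeoS L k M Msz) (fun y : Tor M => y)) (idef (pull π) LinearMap.id F' F)
      (diagK fun _ => o))
    (hDFs : HasMaj (BlockNorm.ofBlocks (unitTorusGeoS L k M Msz) (fun y : Tor M => y)) (BlockNorm.ofBlocks (unitTorusGeoS L k M Msz) (q ∘ π)) (idef LinearMap.id (pull π) Fs' Fs)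
      (diagK fun _ => o)) :
    HasMaj (BlockNorm.ofBlocks (unitTorusGeoS L k M Msz) (fun y : Tor M => y)) (BlockNorm.ofBlocks (unitTorusGeoS L k M Msz) (fun y : Tor M => y))
      (sitePert365F M (q ∘ π) F' Fs' G' Xo' - sitePert365F M q F Fs G Xo)
      (fun y y' => (2 * (1 + r) * B * latticeConst (d + 1) (δ / 2) * (B * o + m * (1 + r)) + 2 * latticeConst (d + 1) (δ / 2) * (β * m₀)) *
        Real.exp (-(δ / 2 * (unitTorusGeoS L k M Msz).dist y y'))) := by
  have hK : 0 ≤ latticeConst (d + 1) (δ / 2) := latticeConst_nonneg _ (by positivity)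
  have htri := triangle254_unitTorusGeo L k M
  have hrow := rowSum_unitTorusGeo L k M (half_pos hδ)
  have hd : ∀ a b : (unitTorusGeoS L k M Msz).Site, 0 ≤ (unitTorusGeoS L k M Msz).dist a b := fun a b => tdistT_nonneg M a b
  have z1 : HasMaj (BlockNorm.ofBlocks (unitTorusGeoS L k M Msz) (fun y : Tor M => y)) (BlockNorm.ofBlocks (unitTorusGeoS L k M Msz) q)
      (0 : (Tor M → ℝ) →ₗ[ℝ] (Xc → ℝ)) (diagK fun _ => 0) := (hasMaj_zero _ _).mono fun _ _ => diagK_nonneg (fun _ => le_rfl) _ _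
  have z2 : HasMaj (BlockNorm.ofBlocks (unitTorusGeoS L k M Msz) (q ∘ π)) (BlockNorm.ofBlocks (unitTorusGeoS L k M Msz) (fun y : Tor M => y))
      (0 : (Xf → ℝ) →ₗ[ℝ] (Tor M → ℝ)) (diagK fun _ => 0) := (hasMaj_zero _ _).mono fun _ _ => diagK_nonneg (fun _ => le_rfl) _ _
  have z3 : HasMaj (BlockNorm.ofBlocks (unitTorusGeoS L k M Msz) (fun y : Tor M => y)) (BlockNorm.ofBlocks (unitTorusGeoS L k M Msz) (q ∘ π))
      (0 : (Tor M → ℝ) →ₗ[ℝ] (Xf → ℝ)) (diagK fun _ => 0) := (hasMaj_zero _ _).mono fun _ _ => diagK_nonneg (fun _ => le_rfl) _ _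
  have z4 : HasMaj (BlockNorm.ofBlocks (unitTorusGeoS L k M Msz) q) (BlockNorm.ofBlocks (unitTorusGeoS L k M Msz) (fun y : Tor M => y))
      (idef (pull π) LinearMap.id (0 : (Xf → ℝ) →ₗ[ℝ] (Tor M → ℝ)) (0 : (Xc → ℝ) →ₗ[ℝ] (Tor M → ℝ))) (diagK fun _ => 0) := by
    rw [idef_zero_zero]; exact (hasMaj_zero _ _).mono fun _ _ => diagK_nonneg (fun _ => le_rfl) _ _
  have z5 : HasMaj (BlockNorm.ofBlocks (unitTorusGeoS L k M Msz) (fun y : Tor M => y)) (BlockNorm.ofBlocks (unitTorusGeoS L k M Msz) (q ∘ π))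
      (idef LinearMap.id (pull π) (0 : (Tor M → ℝ) →ₗ[ℝ] (Xf → ℝ)) (0 : (Tor M → ℝ) →ₗ[ℝ] (Xc → ℝ))) (diagK fun _ => 0) := by
    rw [idef_zero_zero]; exact (hasMaj_zero _ _).mono fun _ _ => diagK_nonneg (fun _ => le_rfl) _ _
  have h1 := hasMaj_idef_siteForm (g := unitTorusGeoS L k M Msz) (σ := δ / 2) (cr := latticeConst (d + 1) (δ / 2)) htri hd hrow (by positivity)
    q (fun y : Tor M => y) q π (fun _ => rfl) hN hfib hB hm hr ho (by positivity : (0 : ℝ) ≤ δ / 2) (by linarith) hX hX' hDX hFs hF' hFs' hDF hDFs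
  have h2 := hasMaj_idef_siteForm (g := unitTorusGeoS L k M Msz) (σ := δ / 2) (cr := latticeConst (d + 1) (δ / 2)) htri hd hrow (by positivity)
    q (fun y : Tor M => y) q π (fun _ => rfl) hN hfib hβ hm₀ le_rfl le_rfl (by positivity : (0 : ℝ) ≤ δ / 2) (by linarith) hG hG' hDG z1 z2 z3 z4 z5
  rw [sitePert365F_sub]
  refine (h1.sub h2).mono fun y y' => le_of_eq ?_
  ring

end Words

/-! ## §2 ★★★ The three site letters from block letters, species live, uniformly over a family -/

section Letters

variable {I : Type} (Mn : I → Fin (d + 1) → ℕ) [hMn0 : ∀ i μ, NeZero (Mn i μ)] (kk : I → ℕ) (Msz : I → ℝ)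
  (Xc Xf : I → Type) [∀ i, Fintype (Xc i)] [∀ i, DecidableEq (Xc i)] [∀ i, Fintype (Xf i)] (q : ∀ i, Xc i → Tor (Mn i)) (π : ∀ i, Xf i → Xc i)
  (Bc Bf : I → B9.Backgrounds) (avg : ∀ i, (Bf i).Cfg → (Bc i).Cfg)
  (Gc : ∀ i, (Xc i → ℝ) →ₗ[ℝ] (Xc i → ℝ)) (Gf : ∀ i, (Xf i → ℝ) →ₗ[ℝ] (Xf i → ℝ))
  (Xco : ∀ i, (Bc i).Cfg → (Xc i → ℝ) →ₗ[ℝ] (Xc i → ℝ)) (Xfo : ∀ i, (Bf i).Cfg → (Xf i → ℝ) →ₗ[ℝ] (Xf i → ℝ))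
  (Fc : ∀ i, (Bc i).Cfg → (Xc i → ℝ) →ₗ[ℝ] (Tor (Mn i) → ℝ)) (Fsc : ∀ i, (Bc i).Cfg → (Tor (Mn i) → ℝ) →ₗ[ℝ] (Xc i → ℝ))
  (Ff : ∀ i, (Bf i).Cfg → (Xf i → ℝ) →ₗ[ℝ] (Tor (Mn i) → ℝ)) (Fsf : ∀ i, (Bf i).Cfg → (Tor (Mn i) → ℝ) →ₗ[ℝ] (Xf i → ℝ))

/-- ★★★ **THE SITE LETTERS FROM BLOCK LETTERS, AVERAGING SPECIES LIVE.**  Part V's `siteLetters_of_dressedLetters` with the species `Fc∕Fsc` (coarse run, at `Ū`) and `Ff∕Fsf` (fine run,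
at `U`) carrying SIZES `≤ diagK (r₀α₀)` and FITS `𝔇(F′, F) ≤ diagK (o₀·r_i)`, `𝔇(Fs′, Fs) ≤ diagK (o₀·r_i)` (`r_i = (L^{k i})^{−γ_P}`) under `Reg335 c₃₅ α₀ U`, `α₀ ≤ a₁` — the three
letters of parts II∕IV for `Pf i U := siteEntries (sitePert365F (q i ∘ π i) (Ff i U) (Fsf i U) (Gf i) (Xfo i U))`, `Pc i V := siteEntries (sitePert365F (q i) (Fc i V) (Fsc i V) (Gc i) (Xco i V))`,
constants `(δ∕2, (r₀B²(1 + r₀a₁) + B²r₀ + (B+β)ε)c_δ + 1, 2(1 + r₀a₁)Bc_δ(Bo₀ + m(1 + r₀a₁)) + 2c_δβm₀ + 1, a₁)`. [cite: Balaban1985BackgroundPropagators, (3.58) p.402, (3.65)–(3.67)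
p.403 (mechanism); King1986, p.664 (pairing)] -/
theorem siteLettersF_of_dressedLetters (c35 : ℝ) {γP : ℝ}
    (hfib : ∀ i, ∃ N : ℕ, N ≠ 0 ∧ ∀ x, (fibre (π i) x).card = N)
    (hL : ∃ β B ε m m₀ r₀ o₀ δ a₁ : ℝ, 0 ≤ β ∧ 0 ≤ B ∧ 0 < ε ∧ 0 ≤ m ∧ 0 ≤ m₀ ∧ 0 ≤ r₀ ∧ 0 ≤ o₀ ∧ 0 < δ ∧ 0 < a₁ ∧ ∀ i : I,
      HasMaj (BlockNorm.ofBlocks (unitTorusGeoS L (kk i) (Mn i) (Msz i)) (q i)) (BlockNorm.ofBlocks (unitTorusGeoS L (kk i) (Mn i) (Msz i)) (q i)) (Gc i)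
        (fun y y' => β * Real.exp (-(δ * (unitTorusGeoS L (kk i) (Mn i) (Msz i)).dist y y'))) ∧
      HasMaj (BlockNorm.ofBlocks (unitTorusGeoS L (kk i) (Mn i) (Msz i)) (q i ∘ π i)) (BlockNorm.ofBlocks (unitTorusGeoS L (kk i) (Mn i) (Msz i)) (q i ∘ π i)) (Gf i)
        (fun y y' => β * Real.exp (-(δ * (unitTorusGeoS L (kk i) (Mn i) (Msz i)).dist y y'))) ∧
      HasMaj (BlockNorm.ofBlocks (unitTorusGeoS L (kk i) (Mn i) (Msz i)) (q i)) (BlockNorm.ofBlocks (unitTorusGeoS L (kk i) (Mn i) (Msz i)) (q i ∘ π i))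
        (idef (pull (π i)) (pull (π i)) (Gf i) (Gc i)) (fun y y' => m₀ * ((L : ℝ) ^ kk i) ^ (-γP) * Real.exp (-(δ * (unitTorusGeoS L (kk i) (Mn i) (Msz i)).dist y y'))) ∧
      ∀ (α₀ : ℝ), 0 < α₀ → α₀ ≤ a₁ → ∀ U : (Bf i).Cfg, (Bf i).Reg335 c35 α₀ U →
        HasMaj (BlockNorm.ofBlocks (unitTorusGeoS L (kk i) (Mn i) (Msz i)) (q i)) (BlockNorm.ofBlocks (unitTorusGeoS L (kk i) (Mn i) (Msz i)) (q i)) (Xco i (avg i U))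
          (fun y y' => B * Real.exp (-(δ * (unitTorusGeoS L (kk i) (Mn i) (Msz i)).dist y y'))) ∧
        HasMaj (BlockNorm.ofBlocks (unitTorusGeoS L (kk i) (Mn i) (Msz i)) (q i ∘ π i)) (BlockNorm.ofBlocks (unitTorusGeoS L (kk i) (Mn i) (Msz i)) (q i ∘ π i)) (Xfo i U)
          (fun y y' => B * Real.exp (-(δ * (unitTorusGeoS L (kk i) (Mn i) (Msz i)).dist y y'))) ∧
        HasMaj (BlockNorm.ofBlocks (unitTorusGeoS L (kk i) (Mn i) (Msz i)) (q i)) (BlockNorm.ofBlocks (unitTorusGeoS L (kk i) (Mn i) (Msz i)) (q i)) (Xco i (avg i U) - Gc i)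
          (fun y y' => ε * α₀ * Real.exp (-(δ * (unitTorusGeoS L (kk i) (Mn i) (Msz i)).dist y y'))) ∧
        HasMaj (BlockNorm.ofBlocks (unitTorusGeoS L (kk i) (Mn i) (Msz i)) (q i ∘ π i)) (BlockNorm.ofBlocks (unitTorusGeoS L (kk i) (Mn i) (Msz i)) (q i ∘ π i))
          (Xfo i U - Gf i) (fun y y' => ε * α₀ * Real.exp (-(δ * (unitTorusGeoS L (kk i) (Mn i) (Msz i)).dist y y'))) ∧
        HasMaj (BlockNorm.ofBlocks (unitTorusGeoS L (kk i) (Mn i) (Msz i)) (q i)) (BlockNorm.ofBlocks (unitTorusGeoS L (kk i) (Mn i) (Msz i)) (q i ∘ π i))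
          (idef (pull (π i)) (pull (π i)) (Xfo i U) (Xco i (avg i U)))
          (fun y y' => m * ((L : ℝ) ^ kk i) ^ (-γP) * Real.exp (-(δ * (unitTorusGeoS L (kk i) (Mn i) (Msz i)).dist y y'))) ∧
        HasMaj (BlockNorm.ofBlocks (unitTorusGeoS L (kk i) (Mn i) (Msz i)) (q i)) (BlockNorm.ofBlocks (unitTorusGeoS L (kk i) (Mn i) (Msz i)) (fun y : Tor (Mn i) => y))
          (Fc i (avg i U)) (diagK fun _ => r₀ * α₀) ∧
        HasMaj (BlockNorm.ofBlocks (unitTorusGeoS L (kk i) (Mn i) (Msz i)) (fun y : Tor (Mn i) => y)) (BlockNorm.ofBlocks (unitTorusGeoS L (kk i) (Mn i) (Msz i)) (q i))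
          (Fsc i (avg i U)) (diagK fun _ => r₀ * α₀) ∧
        HasMaj (BlockNorm.ofBlocks (unitTorusGeoS L (kk i) (Mn i) (Msz i)) (q i ∘ π i)) (BlockNorm.ofBlocks (unitTorusGeoS L (kk i) (Mn i) (Msz i)) (fun y : Tor (Mn i) => y))
          (Ff i U) (diagK fun _ => r₀ * α₀) ∧
        HasMaj (BlockNorm.ofBlocks (unitTorusGeoS L (kk i) (Mn i) (Msz i)) (fun y : Tor (Mn i) => y)) (BlockNorm.ofBlocks (unitTorusGeoS L (kk i) (Mn i) (Msz i)) (q i ∘ π i))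
          (Fsf i U) (diagK fun _ => r₀ * α₀) ∧
        HasMaj (BlockNorm.ofBlocks (unitTorusGeoS L (kk i) (Mn i) (Msz i)) (q i)) (BlockNorm.ofBlocks (unitTorusGeoS L (kk i) (Mn i) (Msz i)) (fun y : Tor (Mn i) => y))
          (idef (pull (π i)) LinearMap.id (Ff i U) (Fc i (avg i U))) (diagK fun _ => o₀ * ((L : ℝ) ^ kk i) ^ (-γP)) ∧
        HasMaj (BlockNorm.ofBlocks (unitTorusGeoS L (kk i) (Mn i) (Msz i)) (fun y : Tor (Mn i) => y)) (BlockNorm.ofBlocks (unitTorusGeoS L (kk i) (Mn i) (Msz i)) (q i ∘ π i))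
          (idef LinearMap.id (pull (π i)) (Fsf i U) (Fsc i (avg i U))) (diagK fun _ => o₀ * ((L : ℝ) ^ kk i) ^ (-γP))) :
    ∃ δP ζ τ a₁ : ℝ, 0 < δP ∧ 0 < ζ ∧ 0 < τ ∧ 0 < a₁ ∧
      ∀ (i : I) (α₀ : ℝ), 0 < α₀ → α₀ ≤ a₁ → ∀ U : (Bf i).Cfg, (Bf i).Reg335 c35 α₀ U →
        (∀ p p' : Idx (Mn i), |siteEntries (Mn i) (sitePert365F (Mn i) (q i) (Fc i (avg i U)) (Fsc i (avg i U)) (Gc i) (Xco i (avg i U))) p p'|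
            ≤ ζ * α₀ * Real.exp (-(δP * tdist (Mn i) p p'))) ∧
        (∀ p p' : Idx (Mn i), |siteEntries (Mn i) (sitePert365F (Mn i) (q i ∘ π i) (Ff i U) (Fsf i U) (Gf i) (Xfo i U)) p p'| ≤ ζ * α₀ * Real.exp (-(δP * tdist (Mn i) p p'))) ∧
        (∀ p p' : Idx (Mn i), |siteEntries (Mn i) (sitePert365F (Mn i) (q i ∘ π i) (Ff i U) (Fsf i U) (Gf i) (Xfo i U)) p p'
              - siteEntries (Mn i) (sitePert365F (Mn i) (q i) (Fc i (avg i U)) (Fsc i (avg i U)) (Gc i) (Xco i (avg i U))) p p'|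
            ≤ τ * ((L : ℝ) ^ kk i) ^ (-γP) * Real.exp (-(δP * tdist (Mn i) p p'))) := by
  obtain ⟨β, B, ε, m, m₀, r₀, o₀, δ, a₁, hβ, hB, hε, hm, hm₀, hr₀, ho₀, hδ, ha₁, H⟩ := hL
  have hLr : (0 : ℝ) ≤ (L : ℝ) := Nat.cast_nonneg _
  obtain ⟨c, hcdef⟩ : ∃ c : ℝ, c = latticeConst (d + 1) (δ / 2) := ⟨_, rfl⟩
  have hc : 0 ≤ c := hcdef ▸ latticeConst_nonneg _ (by positivity)
  obtain ⟨R, hRdef⟩ : ∃ R : ℝ, R = r₀ * a₁ := ⟨_, rfl⟩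
  have hR : 0 ≤ R := hRdef ▸ mul_nonneg hr₀ ha₁.le
  refine ⟨δ / 2, (r₀ * (B * B * (1 + R)) + B * B * r₀ + (B + β) * ε) * c + 1, (2 * (1 + R) * B * c * (B * o₀ + m * (1 + R)) + 2 * c * (β * m₀)) + 1, a₁, half_pos hδ,
    by positivity, by positivity, ha₁, fun i α₀ hα₀ hαa₁ U hreg => ?_⟩
  obtain ⟨hGc, hGf, hDG, HU⟩ := H i
  obtain ⟨hXc, hXf, hEc, hEf, hDX, hFc, hFsc, hFf, hFsf, hDF, hDFs⟩ := HU α₀ hα₀ hαa₁ U hreg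
  obtain ⟨N, hN, hfibi⟩ := hfib i
  have hr : 0 ≤ ((L : ℝ) ^ kk i) ^ (-γP) := Real.rpow_nonneg (pow_nonneg hLr _) _
  have hrα : 0 ≤ r₀ * α₀ := mul_nonneg hr₀ hα₀.le
  have hrR : r₀ * α₀ ≤ R := hRdef ▸ mul_le_mul_of_nonneg_left hαa₁ hr₀
  -- the size letters (S2 `hasMaj_siteC`)
  have hPc := hasMaj_sitePert365F (L := L) (Mn i) (kk i) (Msz i) (q i) hB hβ (by positivity : 0 ≤ ε * α₀) hrα hδ hXc hGc hEc hFc hFsc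
  have hPf := hasMaj_sitePert365F (L := L) (Mn i) (kk i) (Msz i) (q i ∘ π i) hB hβ (by positivity : 0 ≤ ε * α₀) hrα hδ hXf hGf hEf hFf hFsf
  -- the two-grid letter (S2 `hasMaj_idef_siteForm` with the fits live)
  have hPP := hasMaj_sitePert365F_sub (L := L) (Mn i) (kk i) (Msz i) (q i) (π i) hN hfibi hB hβ (mul_nonneg hm hr) (mul_nonneg hm₀ hr) hrα (mul_nonneg ho₀ hr) hδ
    hXc hXf hDX hGc hGf hDG hFsc hFf hFsf hDF hDFs
  have key : ∀ p p' : Idx (Mn i), (r₀ * α₀ * (B * B * (1 + r₀ * α₀)) + B * B * (r₀ * α₀) + (B + β) * (ε * α₀)) * c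
      ≤ ((r₀ * (B * B * (1 + R)) + B * B * r₀ + (B + β) * ε) * c + 1) * α₀ := fun _ _ => by
    have h1 : r₀ * α₀ * (B * B * (1 + r₀ * α₀)) ≤ r₀ * α₀ * (B * B * (1 + R)) :=
      mul_le_mul_of_nonneg_left (mul_le_mul_of_nonneg_left (by linarith) (mul_nonneg hB hB)) hrα
    have h2 : (r₀ * α₀ * (B * B * (1 + R)) + B * B * (r₀ * α₀) + (B + β) * (ε * α₀)) * c = ((r₀ * (B * B * (1 + R)) + B * B * r₀ + (B + β) * ε) * c) * α₀ := by ring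
    nlinarith [mul_nonneg (mul_nonneg (mul_nonneg (add_nonneg hB hβ) hε.le) hc) hα₀.le, mul_nonneg hc hα₀.le]
  refine ⟨fun p p' => ?_, fun p p' => ?_, fun p p' => ?_⟩
  · refine (abs_siteEntries_le_of_hasMaj (L := L) (Mn i) (kk i) (Msz i) hPc p p').trans ?_
    rw [← hcdef]
    exact mul_le_mul_of_nonneg_right (key p p') (Real.exp_nonneg _)
  · refine (abs_siteEntries_le_of_hasMaj (L := L) (Mn i) (kk i) (Msz i) hPf p p').trans ?_
    rw [← hcdef]
    exact mul_le_mul_of_nonneg_right (key p p') (Real.exp_nonneg _)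
  · rw [← Matrix.sub_apply, ← siteEntries_sub]
    refine (abs_siteEntries_le_of_hasMaj (L := L) (Mn i) (kk i) (Msz i) hPP p p').trans ?_
    rw [← hcdef]
    have hE := Real.exp_nonneg (-(δ / 2 * tdist (Mn i) p p'))
    have h1 : 2 * (1 + r₀ * α₀) * B * c * (B * (o₀ * ((L : ℝ) ^ kk i) ^ (-γP)) + m * ((L : ℝ) ^ kk i) ^ (-γP) * (1 + r₀ * α₀)) + 2 * c * (β * (m₀ * ((L : ℝ) ^ kk i) ^ (-γP)))
        = (2 * (1 + r₀ * α₀) * B * c * (B * o₀ + m * (1 + r₀ * α₀)) + 2 * c * (β * m₀)) * ((L : ℝ) ^ kk i) ^ (-γP) := by ring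
    rw [h1]
    refine mul_le_mul_of_nonneg_right (mul_le_mul_of_nonneg_right ?_ hr) hE
    have h2 : 2 * (1 + r₀ * α₀) * B * c * (B * o₀ + m * (1 + r₀ * α₀)) ≤ 2 * (1 + R) * B * c * (B * o₀ + m * (1 + R)) := by
      have a1 : (1 + r₀ * α₀) ≤ 1 + R := by linarith
      have a0 : 0 ≤ 1 + r₀ * α₀ := by linarith
      have b1 : B * o₀ + m * (1 + r₀ * α₀) ≤ B * o₀ + m * (1 + R) := by nlinarith
      have b0 : 0 ≤ B * o₀ + m * (1 + r₀ * α₀) := by positivity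
      calc 2 * (1 + r₀ * α₀) * B * c * (B * o₀ + m * (1 + r₀ * α₀)) ≤ 2 * (1 + R) * B * c * (B * o₀ + m * (1 + r₀ * α₀)) := by
            have := mul_le_mul_of_nonneg_right a1 (mul_nonneg (mul_nonneg (by norm_num : (0:ℝ) ≤ 2) hB) hc)
            nlinarith
        _ ≤ 2 * (1 + R) * B * c * (B * o₀ + m * (1 + R)) := mul_le_mul_of_nonneg_left b1 (by positivity)
    linarith

end Letters

/-! ## §3 ★★★ The site layer over the general carrier from the full (3.65) words' block letters (part IV's socket ∘ §2) -/

section Socket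

open Literature.MathematicalPhysics.QuantumFieldTheory.Balaban1983to89.T4EtaRate (PairedInstance EtaPairing NE2PlusSite)
open Literature.MathematicalPhysics.QuantumFieldTheory.King1986 (aK)
open Summit.QuantumFields.YangMills.BalabanUVNodes.N15.OperatorReadout (opGeo)

variable [NeZero L] {I : Type} (Mn : I → Fin (d + 1) → ℕ) [hMn0 : ∀ i μ, NeZero (Mn i μ)] (kk mm : I → ℕ) (Msz : I → ℝ) (X : I → Type) [∀ i, Fintype (X i)]
  (blk : ∀ i, X i → Tor (Mn i)) (gf : I → B9.Geometry) (Bc Bf : I → B9.Backgrounds)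
  (Xc Xf : I → Type) [∀ i, Fintype (Xc i)] [∀ i, DecidableEq (Xc i)] [∀ i, Fintype (Xf i)] (q : ∀ i, Xc i → Tor (Mn i)) (π : ∀ i, Xf i → Xc i)
  (Gc : ∀ i, (Xc i → ℝ) →ₗ[ℝ] (Xc i → ℝ)) (Gf : ∀ i, (Xf i → ℝ) →ₗ[ℝ] (Xf i → ℝ))
  (Xco : ∀ i, (Bc i).Cfg → (Xc i → ℝ) →ₗ[ℝ] (Xc i → ℝ)) (Xfo : ∀ i, (Bf i).Cfg → (Xf i → ℝ) →ₗ[ℝ] (Xf i → ℝ))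
  (Fc : ∀ i, (Bc i).Cfg → (Xc i → ℝ) →ₗ[ℝ] (Tor (Mn i) → ℝ)) (Fsc : ∀ i, (Bc i).Cfg → (Tor (Mn i) → ℝ) →ₗ[ℝ] (Xc i → ℝ))
  (Ff : ∀ i, (Bf i).Cfg → (Xf i → ℝ) →ₗ[ℝ] (Tor (Mn i) → ℝ)) (Fsf : ∀ i, (Bf i).Cfg → (Tor (Mn i) → ℝ) →ₗ[ℝ] (Xf i → ℝ))

/-- ★★★ **`NE2PlusSite` WITH THE BACKGROUND LIVE FROM THE FULL (3.65) WORDS' BLOCK LETTERS** — part IV's socket fed by §2: the dressed site kernels of the two runs are the genuine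
forms perturbed by `siteEntries (siteForm q F Fs X − siteForm₀ q G)` with the averaging species live; letters of `G`, `X(U)`, `F(U)`, `Fs(U)` are the ONLY input (HYPOTHESES here).
[cite: Balaban1985BackgroundPropagators, Thm 3.2 (3.48) p.398 + Thm 3.14 pp.426–427 (quantifier template), (3.58) p.402, (3.65)–(3.67) p.403 (mechanism); King1986, p.664 (pairing);
CombesThomas1973, §II] -/
theorem ne2PlusSite_sSiteExOn_of_dressedLettersF (hLodd : Odd L) (hL2 : 2 ≤ L) {aS : ℝ} (haS : 0 < aS) (c35 : ℝ) (d' : ℕ) (p : ℝ)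
    {mT : I → ℕ} (hMnT : ∀ i μ, Mn i μ = 2 * L ^ mT i) (hk : ∀ i, 1 ≤ kk i) (hM : ∀ i, 1 ≤ (gf i).M)
    (pair : ∀ i, EtaPairing (opGeo (unitTorusGeoS L (kk i) (Mn i) (Msz i)) (X i) (blk i)) (gf i) (Bc i) (Bf i)) {γP : ℝ} (hγP : 0 < γP)
    (hfib : ∀ i, ∃ N : ℕ, N ≠ 0 ∧ ∀ x, (fibre (π i) x).card = N)
    (hL : ∃ β B ε m m₀ r₀ o₀ δ a₁ : ℝ, 0 ≤ β ∧ 0 ≤ B ∧ 0 < ε ∧ 0 ≤ m ∧ 0 ≤ m₀ ∧ 0 ≤ r₀ ∧ 0 ≤ o₀ ∧ 0 < δ ∧ 0 < a₁ ∧ ∀ i : I,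
      HasMaj (BlockNorm.ofBlocks (unitTorusGeoS L (kk i) (Mn i) (Msz i)) (q i)) (BlockNorm.ofBlocks (unitTorusGeoS L (kk i) (Mn i) (Msz i)) (q i)) (Gc i)
        (fun y y' => β * Real.exp (-(δ * (unitTorusGeoS L (kk i) (Mn i) (Msz i)).dist y y'))) ∧
      HasMaj (BlockNorm.ofBlocks (unitTorusGeoS L (kk i) (Mn i) (Msz i)) (q i ∘ π i)) (BlockNorm.ofBlocks (unitTorusGeoS L (kk i) (Mn i) (Msz i)) (q i ∘ π i)) (Gf i)
        (fun y y' => β * Real.exp (-(δ * (unitTorusGeoS L (kk i) (Mn i) (Msz i)).dist y y'))) ∧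
      HasMaj (BlockNorm.ofBlocks (unitTorusGeoS L (kk i) (Mn i) (Msz i)) (q i)) (BlockNorm.ofBlocks (unitTorusGeoS L (kk i) (Mn i) (Msz i)) (q i ∘ π i))
        (idef (pull (π i)) (pull (π i)) (Gf i) (Gc i)) (fun y y' => m₀ * ((L : ℝ) ^ kk i) ^ (-γP) * Real.exp (-(δ * (unitTorusGeoS L (kk i) (Mn i) (Msz i)).dist y y'))) ∧
      ∀ (α₀ : ℝ), 0 < α₀ → α₀ ≤ a₁ → ∀ U : (Bf i).Cfg, (Bf i).Reg335 c35 α₀ U →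
        HasMaj (BlockNorm.ofBlocks (unitTorusGeoS L (kk i) (Mn i) (Msz i)) (q i)) (BlockNorm.ofBlocks (unitTorusGeoS L (kk i) (Mn i) (Msz i)) (q i))
          (Xco i ((pair i).avg U)) (fun y y' => B * Real.exp (-(δ * (unitTorusGeoS L (kk i) (Mn i) (Msz i)).dist y y'))) ∧
        HasMaj (BlockNorm.ofBlocks (unitTorusGeoS L (kk i) (Mn i) (Msz i)) (q i ∘ π i)) (BlockNorm.ofBlocks (unitTorusGeoS L (kk i) (Mn i) (Msz i)) (q i ∘ π i)) (Xfo i U)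
          (fun y y' => B * Real.exp (-(δ * (unitTorusGeoS L (kk i) (Mn i) (Msz i)).dist y y'))) ∧
        HasMaj (BlockNorm.ofBlocks (unitTorusGeoS L (kk i) (Mn i) (Msz i)) (q i)) (BlockNorm.ofBlocks (unitTorusGeoS L (kk i) (Mn i) (Msz i)) (q i))
          (Xco i ((pair i).avg U) - Gc i) (fun y y' => ε * α₀ * Real.exp (-(δ * (unitTorusGeoS L (kk i) (Mn i) (Msz i)).dist y y'))) ∧
        HasMaj (BlockNorm.ofBlocks (unitTorusGeoS L (kk i) (Mn i) (Msz i)) (q i ∘ π i)) (BlockNorm.ofBlocks (unitTorusGeoS L (kk i) (Mn i) (Msz i)) (q i ∘ π i))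
          (Xfo i U - Gf i) (fun y y' => ε * α₀ * Real.exp (-(δ * (unitTorusGeoS L (kk i) (Mn i) (Msz i)).dist y y'))) ∧
        HasMaj (BlockNorm.ofBlocks (unitTorusGeoS L (kk i) (Mn i) (Msz i)) (q i)) (BlockNorm.ofBlocks (unitTorusGeoS L (kk i) (Mn i) (Msz i)) (q i ∘ π i))
          (idef (pull (π i)) (pull (π i)) (Xfo i U) (Xco i ((pair i).avg U)))
          (fun y y' => m * ((L : ℝ) ^ kk i) ^ (-γP) * Real.exp (-(δ * (unitTorusGeoS L (kk i) (Mn i) (Msz i)).dist y y'))) ∧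
        HasMaj (BlockNorm.ofBlocks (unitTorusGeoS L (kk i) (Mn i) (Msz i)) (q i)) (BlockNorm.ofBlocks (unitTorusGeoS L (kk i) (Mn i) (Msz i)) (fun y : Tor (Mn i) => y))
          (Fc i ((pair i).avg U)) (diagK fun _ => r₀ * α₀) ∧
        HasMaj (BlockNorm.ofBlocks (unitTorusGeoS L (kk i) (Mn i) (Msz i)) (fun y : Tor (Mn i) => y)) (BlockNorm.ofBlocks (unitTorusGeoS L (kk i) (Mn i) (Msz i)) (q i))
          (Fsc i ((pair i).avg U)) (diagK fun _ => r₀ * α₀) ∧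
        HasMaj (BlockNorm.ofBlocks (unitTorusGeoS L (kk i) (Mn i) (Msz i)) (q i ∘ π i)) (BlockNorm.ofBlocks (unitTorusGeoS L (kk i) (Mn i) (Msz i)) (fun y : Tor (Mn i) => y))
          (Ff i U) (diagK fun _ => r₀ * α₀) ∧
        HasMaj (BlockNorm.ofBlocks (unitTorusGeoS L (kk i) (Mn i) (Msz i)) (fun y : Tor (Mn i) => y)) (BlockNorm.ofBlocks (unitTorusGeoS L (kk i) (Mn i) (Msz i)) (q i ∘ π i))
          (Fsf i U) (diagK fun _ => r₀ * α₀) ∧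
        HasMaj (BlockNorm.ofBlocks (unitTorusGeoS L (kk i) (Mn i) (Msz i)) (q i)) (BlockNorm.ofBlocks (unitTorusGeoS L (kk i) (Mn i) (Msz i)) (fun y : Tor (Mn i) => y))
          (idef (pull (π i)) LinearMap.id (Ff i U) (Fc i ((pair i).avg U))) (diagK fun _ => o₀ * ((L : ℝ) ^ kk i) ^ (-γP)) ∧
        HasMaj (BlockNorm.ofBlocks (unitTorusGeoS L (kk i) (Mn i) (Msz i)) (fun y : Tor (Mn i) => y)) (BlockNorm.ofBlocks (unitTorusGeoS L (kk i) (Mn i) (Msz i)) (q i ∘ π i))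
          (idef LinearMap.id (pull (π i)) (Fsf i U) (Fsc i ((pair i).avg U))) (diagK fun _ => o₀ * ((L : ℝ) ^ kk i) ^ (-γP))) :
    NE2PlusSite d' p c35 (fun i => (⟨opGeo (unitTorusGeoS L (kk i) (Mn i) (Msz i)) (X i) (blk i), gf i, Bc i, Bf i, pair i⟩ : PairedInstance))
      (sSiteExOn Mn kk mm Msz X blk gf Bc Bf aS pair
        (fun i U => siteEntries (Mn i) (sitePert365F (Mn i) (q i ∘ π i) (Ff i U) (Fsf i U) (Gf i) (Xfo i U)))
        (fun i V => siteEntries (Mn i) (sitePert365F (Mn i) (q i) (Fc i V) (Fsc i V) (Gc i) (Xco i V)))) :=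
  ne2PlusSite_sSiteExOn_of_letters Mn kk mm Msz X blk gf Bc Bf hLodd hL2 haS c35 d' p hMnT hk hM pair _ _ hγP
    (siteLettersF_of_dressedLetters (L := L) Mn kk Msz Xc Xf q π Bc Bf (fun i => (pair i).avg) Gc Gf Xco Xfo Fc Fsc Ff Fsf c35 hfib hL)

end Socket

end Summit.QuantumFields.YangMills.BalabanUVNodes.N15.SiteLayerBg

end
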